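import Mathlib
import HarnessLib
import Summits.HubbardSuperconductivity.HubbardSuperconductivity.Theorems.KLProgrammeKLRegimeTwoVolumeTowerBaseFrameDiffSymbol
import Summits.HubbardSuperconductivity.HubbardSuperconductivity.Theorems.KLProgrammeKLRegimeTwoVolumeTowerBaseFrameDiffRows

/-!
# Route `KLProgramme` — crux K3, VL child `KLRegimeVolumeLimitV17F2` (stmt-HubbardSuperconductivity-20440), base of the two-volume tower, atom (ii)
# (`hDrow/hDcol` = conjuncts 4–5 of atom `Hbase`): the `ℓ¹` size of the character sum of the padded scale-`0` frame difference, the plain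
# torus sum of the difference family, and — with the rates `s₀ := β/M`, `s₁ := 1` — the rows and columns of
# `klBaseTransfer L M β μ K′ − klBaseTransfer L M β μ K` bounded by an EXPLICIT `M`-, `L`-FREE constant times the frame increment `ε`
# (cell gate-hubbard-kl, seat p3 g18; `--supports` 20440)

Continuation of `…TowerBaseFrameDiffSymbol` (pointwise data of the padded difference `D̃`: sup, support count, second differences, all `∝ ε`) and
`…TowerBaseFrameDiffRows` (rows/columns of the frame-difference block from ONE plain torus sum):

* §3 **`sum_norm_charSum_paddedDiff_le`** — `Σ_w ‖Σ_q χ•D̃(q)‖ ≤ √W(s₀,s₁)·√(16·4M·L²·N_L)·(S₀ + T₀/(4/(s₀·4M))² + X/(4/(s₁L))²)` by k3c4-p2's unit-step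
  master lemma `sum_norm_charSum_le_of_unitSteps` (free rates; `N_L = 2(klE0β/π+1)(1793klE0L²+704L)`);
* §4 `conj_klAnisoFamily_sub`, **`torusSum_frameDiff_le`** — the plain product-torus sum of the difference family `F_0[K′] − F_0[K]` in the currency of
  `…TowerBaseFrameDiffRows` (`charSum_freqMomentum_eq_charSum_padded`, conjugate orientation by reality);
* (§5, next file `…TowerBaseFrameDiffUniform`) the rate choice `s₀ := β/M`, `s₁ := 1` and conjuncts 4–5 of atom `Hbase` with an `M`-, `L`-free constant.

Hypotheses = the model data of k3c4-p2's thin-pair files (frames of common `C²` size `A`, window facts, `β ≥ 1`, `klE0·β < π(2M−3)`, `4π ≤ zL`,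
a derivative bound `d` of `bgmCutoffSq klE0`, `C²` sizes of the one-factor angular factors, `FrameOK` twice, `coeffNorm_j(K′ ⊖ K) ≤ ε`).  Proofs only;
nothing here asserts any stub of 20440, K3, VL or superconductivity.  [cite: BenfattoGiulianiMastropietro2006, §2.6 (2.81), §2.7 (2.70)–(2.71a), §3 (3.3)]
-/

noncomputable section

namespace Summit.HubbardSuperconductivity.HubbardSuperconductivity.Theorems.TorusFourierL2

set_option linter.dupNamespace false -- summit = problem name (single-conjunct summit), D-0017

open Set Finset Literature.MathematicalPhysics.QuantumLattice Literature.MathematicalPhysics.QuantumLattice.BandSectorCounting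
open Literature.MathematicalPhysics.QuantumLattice.FermiRG Literature.Probability.LatticeModels Literature.Analysis.SpecialFunctions
open Summit.HubbardSuperconductivity.HubbardSuperconductivity.Theorems.DispersionFlow
open Summit.HubbardSuperconductivity.HubbardSuperconductivity.Theorems.KLRegimeSplit
open Summit.HubbardSuperconductivity.HubbardSuperconductivity.Theorems.KLProgrammeLegKernels
open Summit.HubbardSuperconductivity.HubbardSuperconductivity.Theorems.PerturbedFermiCurve
open Summit.HubbardSuperconductivity.HubbardSuperconductivity.Theorems.EngineV8
open scoped Real


/-! ## §3 The `ℓ¹` size of the character sum of the padded difference and the torus sum of the difference family -/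

section ScaleZeroDiffL1

variable {L M : ℕ} [NeZero L] [NeZero M] {K K' : TrigPolyC4v} {A : ℝ}
  (hA : ∀ p : Momentum, ∀ j ≤ 2, ‖iteratedFDeriv ℝ j (frameShift K) p‖ ≤ A)
  (hA' : ∀ p : Momentum, ∀ j ≤ 2, ‖iteratedFDeriv ℝ j (frameShift K') p‖ ≤ A)
  {μ z β : ℝ} (hz : 0 < z) (hz1 : z ≤ 1) (hgap : klE0 + A + z ^ 2 < -μ) (h3 : klE0 + A - μ ≤ 3) (hβ : 0 < β)
  (hMβ : klE0 * β < π * (2 * M - 3))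
  (ω : Fin (sectorCount 0))
  {d : ℝ} (hd : 0 ≤ d) (hd1 : ∀ u, |deriv (bgmCutoffSq klE0) u| ≤ d) (hd2 : ∀ u, |iteratedDeriv 2 (bgmCutoffSq klE0) u| ≤ d)
  (hd3 : ∀ u, |iteratedDeriv 3 (bgmCutoffSq klE0) u| ≤ d)
  {Z : (Fin 2 → ℝ) → ℝ}
  (hZ : ∀ p, Z p = gnCutoff ((π + z) ^ 2 / π ^ 2) ((π + z) ^ 2) (p 0 ^ 2) * gnCutoff ((π + z) ^ 2 / π ^ 2) ((π + z) ^ 2) (p 1 ^ 2) *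
    (radialCutoffC (1 / 2) (momToComplex p) * sectorWeightCirc 0 ((ω : ℕ) : ℤ) (polarAngle p)))
  {z₁ z₂ : ℝ} (hZ1 : ∀ p, ‖fderiv ℝ Z p‖ ≤ z₁) (hZ2 : ∀ p, ‖iteratedFDeriv ℝ 2 Z p‖ ≤ z₂)
  {ε : ℝ} (hε : ∀ j ≤ 2, (fsub K' K).coeffNorm j ≤ ε)
  {R : RenConsts} {U : ℝ} {N : ℕ} (hK : FrameOK R U N μ K) (hK' : FrameOK R U N μ K')

set_option maxHeartbeats 400000 in
include hA hA' hz hz1 hgap h3 hβ hMβ hd hd1 hd2 hd3 hZ hZ1 hZ2 hε hK hK' in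
/-- **`ℓ¹` SIZE OF THE CHARACTER SUM OF THE PADDED SCALE-`0` DIFFERENCE ON TWO FRAMES** (free rates `s₀, s₁ > 0`, `4π ≤ zL`): with `Λ₀ = klScale klE0 0`,
`E₀ = 4+A+|μ|`, `S = d klE0²/Λ₀²·(2E₀ε)`, `T = (4 d klE0⁶/Λ₀² + 2 d klE0⁴/Λ₀²)(2π/β)²(2E₀ε)/Λ₀²`, `X = (2π/L)²·Ξ(ε)`, `N = 2(klE0β/π+1)(1793klE0L²+704L)`:
`Σ_w ‖Σ_q χ • D̃(q)‖ ≤ √W(s₀,s₁)·√(16·4M·L²·N)·(S + T/(4/(s₀·4M))² + X/(4/(s₁L))²)` — LINEAR in the frame increment `ε`.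
[cite: BenfattoGiulianiMastropietro2006, §2.6 (2.81), §2.7 (2.71a), §3 (3.3)] -/
theorem sum_norm_charSum_paddedDiff_le (hzL : 2 * |2 * π / (L : ℝ)| ≤ z) {s₀ s₁ : ℝ} (hs₀ : 0 < s₀) (hs₁ : 0 < s₁) :
    ∑ w : TorusSite 1 (2 * (2 * M)) × TorusSite 2 L, ‖∑ q : TorusSite 1 (2 * (2 * M)) × TorusSite 2 L, (torusChar q.1 w.1 * torusChar q.2 w.2) •
      ((if h : (q.1 0).val < 2 * M then klAnisoFamily L M β μ K' klE0 0 ω (⟨(q.1 0).val, h⟩, q.2) else 0) -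
        (if h : (q.1 0).val < 2 * M then klAnisoFamily L M β μ K klE0 0 ω (⟨(q.1 0).val, h⟩, q.2) else 0))‖ ≤
      Real.sqrt (2048 * (1 / s₀ + 1) * (4 * ((2 * Real.sqrt 2 / s₁ + 2) * (2 * Real.sqrt 2 / s₁ + 2)) + 16 * (1 / s₁ + 1) ^ 2)) *
        Real.sqrt (16 * ((2 * (2 * M) : ℕ) : ℝ) * (L : ℝ) ^ 2 * (2 * ((klE0 * β / π + 1) * (1793 * klE0 * (L : ℝ) ^ 2 + 704 * L)))) *
        (d * klE0 ^ 2 / klScale klE0 0 ^ 2 * (2 * (4 + A + |μ|) * ε * 1) +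
          (4 * (d * klE0 ^ 6 / klScale klE0 0 ^ 2) + 2 * (d * klE0 ^ 4 / klScale klE0 0 ^ 2)) *
            (2 * π / β) ^ 2 * (2 * (4 + A + |μ|) * ε * 1) / klScale klE0 0 ^ 2 / (4 / (s₀ * ((2 * (2 * M) : ℕ) : ℝ))) ^ 2 +
          (2 * π / L) ^ 2 *
            (((4 * (d * klE0 ^ 6 / klScale klE0 0 ^ 2) + 2 * (d * klE0 ^ 4 / klScale klE0 0 ^ 2)) * (4 + 2 * A) ^ 2 / klScale klE0 0 ^ 2 +
                  2 * (d * klE0 ^ 4 / klScale klE0 0 ^ 2) * (4 + 4 * A) / klScale klE0 0) * (2 * (4 + A + |μ|) * ε * 1) +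
              4 * (d * klE0 ^ 4 / klScale klE0 0 ^ 2) * (4 + 2 * A) / klScale klE0 0 *
                (2 * (((4 + 2 * A) * ε + (4 + A + |μ|) * (2 * ε)) * 1 + (4 + A + |μ|) * ε * z₁)) +
              d * klE0 ^ 2 / klScale klE0 0 ^ 2 *
                (2 * (((4 + 4 * A) * ε + 2 * (4 + 2 * A) * (2 * ε) + (4 + A + |μ|) * (4 * ε)) * 1 +
                  2 * ((4 + 2 * A) * ε + (4 + A + |μ|) * (2 * ε)) * z₁ + (4 + A + |μ|) * ε * z₂))) /
            (4 / (s₁ * L)) ^ 2) := by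
  classical
  haveI : NeZero (2 * (2 * M)) := ⟨by have := NeZero.ne M; omega⟩
  have hL : (0 : ℝ) < L := Nat.cast_pos.2 (Nat.pos_of_ne_zero (NeZero.ne L))
  have hΛ : 0 < klScale klE0 0 := by rw [klScale]; norm_num [klE0]
  have hA0 : 0 ≤ A := le_trans (norm_nonneg _) (hA 0 0 (by norm_num))
  have hε0 : 0 ≤ ε := le_trans (TrigPolyC4v.coeffNorm_nonneg 0 _) (hε 0 (by norm_num))
  have hz₁ : 0 ≤ z₁ := le_trans (norm_nonneg _) (hZ1 0)
  have hz₂ : 0 ≤ z₂ := le_trans (norm_nonneg _) (hZ2 0)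
  have he : (0 : ℝ) ≤ klE0 := by norm_num [klE0]
  set Dp : TorusSite 1 (2 * (2 * M)) × TorusSite 2 L → ℂ := fun q =>
    (if h : (q.1 0).val < 2 * M then klAnisoFamily L M β μ K' klE0 0 ω (⟨(q.1 0).val, h⟩, q.2) else 0) -
      (if h : (q.1 0).val < 2 * M then klAnisoFamily L M β μ K klE0 0 ω (⟨(q.1 0).val, h⟩, q.2) else 0) with hDpdef
  have hDp : ∀ q, Dp q = (if h : (q.1 0).val < 2 * M then klAnisoFamily L M β μ K' klE0 0 ω (⟨(q.1 0).val, h⟩, q.2) else 0) -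
      (if h : (q.1 0).val < 2 * M then klAnisoFamily L M β μ K klE0 0 ω (⟨(q.1 0).val, h⟩, q.2) else 0) := fun q => rfl
  -- the four inputs
  have hsup := norm_paddedDiff_le hA hA' hz h3 hβ hMβ ω hd1 hd2 hd3 hZ hε hDp
  have hNs := card_support_paddedDiff_le hβ hMβ ω hDp hK hK'
  have h0 := norm_fwdDiff_two_time_paddedDiff_le hA hA' hz h3 hβ hMβ ω hd hd1 hd2 hd3 hZ hε hDp
  have hsp := norm_fwdDiff_two_space_paddedDiff_le hA hA' hz hz1 hgap h3 hβ hMβ ω hd hd1 hd2 hd3 hZ hZ1 hZ2 hε hDp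
  set Ξ : ℝ := (((4 * (d * klE0 ^ 6 / klScale klE0 0 ^ 2) + 2 * (d * klE0 ^ 4 / klScale klE0 0 ^ 2)) * (4 + 2 * A) ^ 2 / klScale klE0 0 ^ 2 +
                  2 * (d * klE0 ^ 4 / klScale klE0 0 ^ 2) * (4 + 4 * A) / klScale klE0 0) * (2 * (4 + A + |μ|) * ε * 1) +
              4 * (d * klE0 ^ 4 / klScale klE0 0 ^ 2) * (4 + 2 * A) / klScale klE0 0 *
                (2 * (((4 + 2 * A) * ε + (4 + A + |μ|) * (2 * ε)) * 1 + (4 + A + |μ|) * ε * z₁)) +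
              d * klE0 ^ 2 / klScale klE0 0 ^ 2 *
                (2 * (((4 + 4 * A) * ε + 2 * (4 + 2 * A) * (2 * ε) + (4 + A + |μ|) * (4 * ε)) * 1 +
                  2 * ((4 + 2 * A) * ε + (4 + A + |μ|) * (2 * ε)) * z₁ + (4 + A + |μ|) * ε * z₂))) with hΞ
  have hΞ0 : 0 ≤ Ξ := by rw [hΞ]; positivity
  clear_value Ξ
  have h1 : ∀ u : Fin 2 → ℤ, (∀ j, |u j| ≤ 1) → ∀ q,
      ‖((fwdDiff ((0 : TorusSite 1 (2 * (2 * M))), (fun j => ((u j : ℤ) : ZMod L))))^[2] Dp) q‖ ≤ (2 * π / L) ^ 2 * Ξ := by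
    intro u hu1 q
    have hu1' : ∀ j, |(u j : ℝ)| ≤ 1 := fun j => by exact_mod_cast hu1 j
    have hu : ∀ j, 2 * |2 * π / (L : ℝ)| * |(u j : ℝ)| ≤ z := fun j =>
      (mul_le_of_le_one_right (by positivity) (hu1' j)).trans hzL
    have hw : ‖(fun j => 2 * π / L * (u j : ℝ))‖ ≤ 2 * π / L := by
      refine (pi_norm_le_iff_of_nonneg (by positivity)).2 fun j => ?_
      rw [Real.norm_eq_abs, abs_mul, abs_of_pos (by positivity : (0 : ℝ) < 2 * π / L)]
      exact mul_le_of_le_one_right (by positivity) (hu1' j)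
    refine (hsp u hu q).trans ?_
    exact mul_le_mul_of_nonneg_right (pow_le_pow_left₀ (norm_nonneg _) hw 2) hΞ0
  have hS0 : 0 ≤ d * klE0 ^ 2 / klScale klE0 0 ^ 2 * (2 * (4 + A + |μ|) * ε * 1) := by positivity
  have hT0 : 0 ≤ (4 * (d * klE0 ^ 6 / klScale klE0 0 ^ 2) + 2 * (d * klE0 ^ 4 / klScale klE0 0 ^ 2)) *
        (2 * π / β) ^ 2 * (2 * (4 + A + |μ|) * ε * 1) / klScale klE0 0 ^ 2 := by positivity
  have hX0 : 0 ≤ (2 * π / L) ^ 2 * Ξ := mul_nonneg (by positivity) hΞ0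
  have main := sum_norm_charSum_le_of_unitSteps (P := 2 * (2 * M)) Dp hS0 hT0 hX0
    (Ns := (univ.filter fun q : TorusSite 1 (2 * (2 * M)) × TorusSite 2 L => Dp q ≠ 0).card) le_rfl hsup h0 h1 hs₀ hs₁
  refine main.trans ?_
  have hamp : 0 ≤ d * klE0 ^ 2 / klScale klE0 0 ^ 2 * (2 * (4 + A + |μ|) * ε * 1) +
      (4 * (d * klE0 ^ 6 / klScale klE0 0 ^ 2) + 2 * (d * klE0 ^ 4 / klScale klE0 0 ^ 2)) *
        (2 * π / β) ^ 2 * (2 * (4 + A + |μ|) * ε * 1) / klScale klE0 0 ^ 2 / (4 / (s₀ * ((2 * (2 * M) : ℕ) : ℝ))) ^ 2 +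
      (2 * π / L) ^ 2 * Ξ / (4 / (s₁ * L)) ^ 2 :=
    add_nonneg (add_nonneg hS0 (div_nonneg hT0 (by positivity))) (div_nonneg hX0 (by positivity))
  gcongr

end ScaleZeroDiffL1

/-! ## §4 The torus sum of the difference family and the `M`-uniform frame-difference rows of the base transfer -/

section ScaleZeroDiffRows

variable {L M : ℕ} [NeZero L] [NeZero M] {K K' : TrigPolyC4v} {A : ℝ}
  (hA : ∀ p : Momentum, ∀ j ≤ 2, ‖iteratedFDeriv ℝ j (frameShift K) p‖ ≤ A)
  (hA' : ∀ p : Momentum, ∀ j ≤ 2, ‖iteratedFDeriv ℝ j (frameShift K') p‖ ≤ A)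
  {μ z β : ℝ} (hz : 0 < z) (hz1 : z ≤ 1) (hgap : klE0 + A + z ^ 2 < -μ) (h3 : klE0 + A - μ ≤ 3) (hβ : 0 < β)
  (hMβ : klE0 * β < π * (2 * M - 3))
  {d : ℝ} (hd : 0 ≤ d) (hd1 : ∀ u, |deriv (bgmCutoffSq klE0) u| ≤ d) (hd2 : ∀ u, |iteratedDeriv 2 (bgmCutoffSq klE0) u| ≤ d)
  (hd3 : ∀ u, |iteratedDeriv 3 (bgmCutoffSq klE0) u| ≤ d)
  {z₁ z₂ : ℝ}
  (hZb : ∀ ω : Fin (sectorCount 0), ∀ p,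
    ‖fderiv ℝ (fun p : Fin 2 → ℝ => gnCutoff ((π + z) ^ 2 / π ^ 2) ((π + z) ^ 2) (p 0 ^ 2) * gnCutoff ((π + z) ^ 2 / π ^ 2) ((π + z) ^ 2) (p 1 ^ 2) *
      (radialCutoffC (1 / 2) (momToComplex p) * sectorWeightCirc 0 ((ω : ℕ) : ℤ) (polarAngle p))) p‖ ≤ z₁ ∧
    ‖iteratedFDeriv ℝ 2 (fun p : Fin 2 → ℝ => gnCutoff ((π + z) ^ 2 / π ^ 2) ((π + z) ^ 2) (p 0 ^ 2) *
      gnCutoff ((π + z) ^ 2 / π ^ 2) ((π + z) ^ 2) (p 1 ^ 2) *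
      (radialCutoffC (1 / 2) (momToComplex p) * sectorWeightCirc 0 ((ω : ℕ) : ℤ) (polarAngle p))) p‖ ≤ z₂)
  {ε : ℝ} (hε : ∀ j ≤ 2, (fsub K' K).coeffNorm j ≤ ε)
  {R : RenConsts} {U : ℝ} {N : ℕ} (hK : FrameOK R U N μ K) (hK' : FrameOK R U N μ K')

omit [NeZero L] [NeZero M] in
/-- The difference family is real: `conj (F_0[K′] − F_0[K]) = F_0[K′] − F_0[K]`. [folklore] -/
theorem conj_klAnisoFamily_sub (ω : Fin (sectorCount 0)) (k : FreqMomentum L M) :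
    (starRingEnd ℂ) (klAnisoFamily L M β μ K' klE0 0 ω k - klAnisoFamily L M β μ K klE0 0 ω k) =
      klAnisoFamily L M β μ K' klE0 0 ω k - klAnisoFamily L M β μ K klE0 0 ω k := by
  rw [map_sub, conj_klAnisoFamily, conj_klAnisoFamily]

set_option maxHeartbeats 400000 in
include hA hA' hz hz1 hgap h3 hβ hMβ hd hd1 hd2 hd3 hZb hε hK hK' in
/-- **THE PLAIN TORUS SUM OF THE SCALE-`0` FRAME-DIFFERENCE FAMILY** (the input `hT` of `…TowerBaseFrameDiffRows`, free rates `s₀, s₁ > 0`, `4π ≤ zL`):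
for every sector `ω` and charge `c`, `(|β|L²)⁻¹ Σ_{(d,w)} ‖Σ_k (F_0[K′] − F_0[K])_ω(k) Χ_c(k; d, w)‖ ≤ (|β|L²)⁻¹·√W(s₀,s₁)·√(16·4M·L²·N)·Amp(ε)` with the
constants of `sum_norm_charSum_paddedDiff_le`. [cite: BenfattoGiulianiMastropietro2006, §2.6 (2.81), §2.7 (2.71a), §3 (3.3)] -/
theorem torusSum_frameDiff_le (hzL : 2 * |2 * π / (L : ℝ)| ≤ z) {s₀ s₁ : ℝ} (hs₀ : 0 < s₀) (hs₁ : 0 < s₁) (ω : Fin (sectorCount 0)) (c : Fin 2) :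
    1 / (|β| * (L : ℝ) ^ 2) *
        ∑ dw : TorusSite 1 (2 * (2 * M)) × TorusSite 2 L,
          ‖∑ k : FreqMomentum L M, (klAnisoFamily L M β μ K' klE0 0 ω k - klAnisoFamily L M β μ K klE0 0 ω k) *
            (if c = 0 then torusChar (fun _ : Fin 1 => ((k.1 : ℕ) : ZMod (2 * (2 * M)))) dw.1 * torusChar k.2 dw.2
              else (starRingEnd ℂ) (torusChar (fun _ : Fin 1 => ((k.1 : ℕ) : ZMod (2 * (2 * M)))) dw.1 * torusChar k.2 dw.2))‖ ≤
      1 / (|β| * (L : ℝ) ^ 2) *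
        (Real.sqrt (2048 * (1 / s₀ + 1) * (4 * ((2 * Real.sqrt 2 / s₁ + 2) * (2 * Real.sqrt 2 / s₁ + 2)) + 16 * (1 / s₁ + 1) ^ 2)) *
          Real.sqrt (16 * ((2 * (2 * M) : ℕ) : ℝ) * (L : ℝ) ^ 2 * (2 * ((klE0 * β / π + 1) * (1793 * klE0 * (L : ℝ) ^ 2 + 704 * L)))) *
          (d * klE0 ^ 2 / klScale klE0 0 ^ 2 * (2 * (4 + A + |μ|) * ε * 1) +
            (4 * (d * klE0 ^ 6 / klScale klE0 0 ^ 2) + 2 * (d * klE0 ^ 4 / klScale klE0 0 ^ 2)) *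
              (2 * π / β) ^ 2 * (2 * (4 + A + |μ|) * ε * 1) / klScale klE0 0 ^ 2 / (4 / (s₀ * ((2 * (2 * M) : ℕ) : ℝ))) ^ 2 +
            (2 * π / L) ^ 2 *
              (((4 * (d * klE0 ^ 6 / klScale klE0 0 ^ 2) + 2 * (d * klE0 ^ 4 / klScale klE0 0 ^ 2)) * (4 + 2 * A) ^ 2 / klScale klE0 0 ^ 2 +
                    2 * (d * klE0 ^ 4 / klScale klE0 0 ^ 2) * (4 + 4 * A) / klScale klE0 0) * (2 * (4 + A + |μ|) * ε * 1) +
                4 * (d * klE0 ^ 4 / klScale klE0 0 ^ 2) * (4 + 2 * A) / klScale klE0 0 *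
                  (2 * (((4 + 2 * A) * ε + (4 + A + |μ|) * (2 * ε)) * 1 + (4 + A + |μ|) * ε * z₁)) +
                d * klE0 ^ 2 / klScale klE0 0 ^ 2 *
                  (2 * (((4 + 4 * A) * ε + 2 * (4 + 2 * A) * (2 * ε) + (4 + A + |μ|) * (4 * ε)) * 1 +
                    2 * ((4 + 2 * A) * ε + (4 + A + |μ|) * (2 * ε)) * z₁ + (4 + A + |μ|) * ε * z₂))) /
              (4 / (s₁ * L)) ^ 2)) := by
  classical
  haveI : NeZero (2 * (2 * M)) := ⟨by have := NeZero.ne M; omega⟩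
  refine mul_le_mul_of_nonneg_left ?_ (by positivity)
  -- the conjugate orientation has the same size
  have hc : ∀ dw : TorusSite 1 (2 * (2 * M)) × TorusSite 2 L,
      ‖∑ k : FreqMomentum L M, (klAnisoFamily L M β μ K' klE0 0 ω k - klAnisoFamily L M β μ K klE0 0 ω k) *
        (if c = 0 then torusChar (fun _ : Fin 1 => ((k.1 : ℕ) : ZMod (2 * (2 * M)))) dw.1 * torusChar k.2 dw.2
          else (starRingEnd ℂ) (torusChar (fun _ : Fin 1 => ((k.1 : ℕ) : ZMod (2 * (2 * M)))) dw.1 * torusChar k.2 dw.2))‖ =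
      ‖∑ k : FreqMomentum L M, (fun ω k => klAnisoFamily L M β μ K' klE0 0 ω k - klAnisoFamily L M β μ K klE0 0 ω k) ω k *
        (torusChar (fun _ : Fin 1 => ((k.1 : ℕ) : ZMod (2 * (2 * M)))) dw.1 * torusChar k.2 dw.2)‖ := by
    intro dw
    by_cases hc0 : c = 0
    · simp only [hc0, if_true]
    · simp only [hc0, if_false]
      exact norm_charSum_conj_eq (fun ω k => klAnisoFamily L M β μ K' klE0 0 ω k - klAnisoFamily L M β μ K klE0 0 ω k)
        (fun ω k => conj_klAnisoFamily_sub ω k) ω dw.1 dw.2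
  have hc' : ∑ dw : TorusSite 1 (2 * (2 * M)) × TorusSite 2 L,
      ‖∑ k : FreqMomentum L M, (klAnisoFamily L M β μ K' klE0 0 ω k - klAnisoFamily L M β μ K klE0 0 ω k) *
        (if c = 0 then torusChar (fun _ : Fin 1 => ((k.1 : ℕ) : ZMod (2 * (2 * M)))) dw.1 * torusChar k.2 dw.2
          else (starRingEnd ℂ) (torusChar (fun _ : Fin 1 => ((k.1 : ℕ) : ZMod (2 * (2 * M)))) dw.1 * torusChar k.2 dw.2))‖ =
      ∑ w : TorusSite 1 (2 * (2 * M)) × TorusSite 2 L, ‖∑ q : TorusSite 1 (2 * (2 * M)) × TorusSite 2 L, (torusChar q.1 w.1 * torusChar q.2 w.2) •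
        ((if h : (q.1 0).val < 2 * M then klAnisoFamily L M β μ K' klE0 0 ω (⟨(q.1 0).val, h⟩, q.2) else 0) -
          (if h : (q.1 0).val < 2 * M then klAnisoFamily L M β μ K klE0 0 ω (⟨(q.1 0).val, h⟩, q.2) else 0))‖ := by
    refine Finset.sum_congr rfl fun dw _ => ?_
    rw [hc dw, charSum_freqMomentum_eq_charSum_padded
      (fun ω k => klAnisoFamily L M β μ K' klE0 0 ω k - klAnisoFamily L M β μ K klE0 0 ω k) ω dw.1 dw.2]
    congr 1
    refine Finset.sum_congr rfl fun q _ => ?_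
    congr 1
    show (if h : (q.1 0).val < 2 * M then
        (fun ω k => klAnisoFamily L M β μ K' klE0 0 ω k - klAnisoFamily L M β μ K klE0 0 ω k) ω (⟨(q.1 0).val, h⟩, q.2) else 0) = _
    split_ifs with h
    · rfl
    · exact (sub_zero 0).symm
  rw [hc']
  exact sum_norm_charSum_paddedDiff_le hA hA' hz hz1 hgap h3 hβ hMβ ω hd hd1 hd2 hd3 (fun _ => rfl) (fun p => (hZb ω p).1)
    (fun p => (hZb ω p).2) hε hK hK' hzL hs₀ hs₁

end ScaleZeroDiffRows

end Summit.HubbardSuperconductivity.HubbardSuperconductivity.Theorems.TorusFourierL2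

end
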